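import Summits.BirchSwinnertonDyer.BirchSwinnertonDyer.Theorems.KimAtThreeFineKatoKPortLogSurjective
import Summits.BirchSwinnertonDyer.BirchSwinnertonDyer.Theorems.KimAtThreeFineKatoKPortReduction
import Summits.BirchSwinnertonDyer.BirchSwinnertonDyer.Theorems.KimAtThreeFineKatoKPortResidueField
import Summits.BirchSwinnertonDyer.BirchSwinnertonDyer.Theorems.KimAtThreeFineKatoKPortLimitLog
import Literature.NumberTheory.EllipticCurves.SingularCubicPointCountProofs
import Literature.NumberTheory.EllipticCurves.ReductionHomomorphismSurjectiveProofs
import HarnessLib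

/-!
# The SHARP receptacle at an additive prime over an UNRAMIFIED `p`-adic field:
# `E₀(K)[p] = 0 ⟹ log_ω(E₀(K)) = 𝒪_K` (Kim–Nakamura Cor. 2.4 / Kosters–Pannekoek, log side, over `K ⊋ ℚ_p`)

Route `EdixhovenFibreFiveSeven`, crux K★ `StarredOptimalManinUnitFiveSeven` (stmt-BirchSwinnertonDyer-22226),
line `kato-lever`, seat `bsd-line-edix-p1` g5; `--supports` 22226 (helper toward the ONE open stub F″ =
`Literature.NumberTheory.EllipticCurves.kato_neron_isIntegral_twistedSymbolSum_of_additive_five_le`; programme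
piece **P2** of `Cruxes/StarredOptimalManinUnitFiveSeven/Lines/kato-lever-F2-programme.md` §4). TOOL theorems only
(no definition, no named fact, no instance, no `sorry`); nothing is closed or booked; BSD is not proved by any of this.

WHY. F″ reads Kato's zeta values in NÉRON units through the receptacle
`exp*_ω(H¹(K_v, T_pE)) = (log_ω E(K_v))^∨ ⊆ 𝒪_{K_v}` at the completions `K_v = ℚ(ζ_m)_v`, `v ∣ p`, `p ∤ m`,
which are UNRAMIFIED over `ℚ_p` of residue degree `f_v = ord_m p ≥ 1`. By the Tate-duality fact (S5b)
`PAdicHodge.exists_smul_range_expStarCoord_iff_trace_log` the range of `exp*_ω` is the trace dual of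
`log_ω(E(K_v))`; the trace self-duality `𝒪_v^∨ = 𝒪_v` at tame cyclotomic completions is the tree's
`KimAtThreeSemiLocalTraceDualLocal.mem_adicCompletionIntegers_of_forall_trace_mul_mem` (any `p`). What was
missing is the E-side LATTICE statement over `K ⊋ ℚ_p`: the tree had `log_ω(E₁(K)) = p𝒪_K`
(`KPort.image_satLog_kernel_of_unramified`, any model, `p` odd), `p • E₀(K) ⊆ E₁(K)` and `‖log_ω‖ ≤ 1` on `E₀(K)`
at a cusp (`KPort.prime_nsmul_mem_kernel_of_mem_nonsingularReductionSubgroup`,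
`norm_satLog_le_one_of_prime_nsmul_mem_of_unramified`), the `ℚ_p`-only index theorem
(`PadicLogLatticeIndexAdditiveProofs`), and the NEGATIVE statement that a torsion point of `E₀(K) ∖ E₁(K)`
PREVENTS `log_ω(E₀(K)) ⊇ 𝒪_K` (w2-acc3 `KimAtThreeAdditiveHiddenTorsionLattice`, the `p = 3` census). This file
proves the POSITIVE twin, for every odd `p`:

> `K ⊇ ℚ_p` finite UNRAMIFIED (`‖x‖ < 1 ⇒ ‖x‖ ≤ ‖p‖`), `M/ℤ_p` with CUSPIDAL reduction (`Δ, c₄ ∈ pℤ_p`),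
> `E₀(K)[p] = 0`  ⟹  `log_ω : E₀(K) ↠ 𝒪_K` (indeed `log_ω(E₀(K)) = 𝒪_K`, `ker = 0`).

Proof (Silverman VII.2.1 + III.2.5/Ex. 3.5 + IV.6.4, counting): `μ = log_ω mod 𝔪 : E₀(K) → k` is additive with
`ker μ ⊆ E₁(K)` (a point with `log_ω P ∈ 𝔪 = p𝒪_K = log_ω(E₁(K))` differs from a point of `E₁(K)` by a
torsion point of `E₀(K)`, which is `p`-power torsion since `E₀/E₁ ↪ k⁺` and `E₁(K)` is torsion-free, hence `O`);
`[E₀(K) : E₁(K)] = #Ẽ_ns(k) = #k` (reduction onto, Hensel; cusp count), so `#k ≥ #im μ = [E₀ : ker μ] ≥ [E₀ : E₁] = #k`,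
`μ` is onto, and `𝒪_K = log_ω(E₀(K)) + 𝔪 = log_ω(E₀(K))` because `𝔪 = log_ω(E₁(K))`.

* §1 (any valued field `(L, w)`, `W₀/𝒪` cuspidal, `k` finite, `𝒪` henselian):
  `index_kernelOfReduction_eq_card_of_cusp` (`[E₀(L) : E₁(L)] = #k`) and the abstract covering lemma
  ★ `forall_exists_eq_of_cusp` — ANY additive `λ : E₀(L) →+ L` with `λ(E₀) ⊆ 𝒪`, `λ⁻¹(𝔪) ⊆ E₁(L)`,
  `𝔪 ⊆ λ(E₀)` covers `𝒪` (the positive twin of `KimAtThreeAdditiveHiddenTorsionLattice.not_forall_exists_eq_…`).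
* §2 (KPort currency `E = BallEval.curveK p K M`, `Λ̃ = KPort.satLog`, `K/ℚ_p` finite unramified, `p` odd, cusp):
  `mem_kernel_of_isOfFinAddOrder_of_noPTorsion` (`E₀(K)[p] = 0 ⇒ E₀(K)_tors ⊆ E₁(K)`, hence `= 0`),
  `mem_kernel_of_norm_satLog_lt_one` (`‖Λ̃ P‖ < 1 ⇒ P ∈ E₁(K)`),
  ★★ `exists_mem_nonsingularReductionSubgroup_satLog_eq` (`Λ̃ : E₀(K) ↠ 𝒪_K`),
  `image_satLog_nonsingularReductionSubgroup_eq` (`Λ̃(E₀(K)) = {‖y‖ ≤ 1}`),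
  `satLog_eq_zero_iff_of_mem_nonsingularReductionSubgroup` (`Λ̃` is injective on `E₀(K)`).
* §3 the same with `Λ̃` replaced by the Literature logarithm `FormalGroupChart.padicLogPointFiniteExt ‖·‖ E p` of
  (S5b) (junction `KPort.satLog_eq_padicLogPointFiniteExt`): `exists_mem_nonsingularReductionSubgroup_padicLogPointFiniteExt_eq`,
  and the TRACE form consumed with (S5b): `norm_trace_mul_le_one_of_forall_point` — if
  `‖Tr_{K/ℚ_p}(a · log_ω P)‖ ≤ 1` for all `P ∈ E(K)` then `‖Tr_{K/ℚ_p}(a · o)‖ ≤ 1` for every `o ∈ 𝒪_K`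
  (so `a ∈ 𝒪_K^∨`, `= 𝒪_K` for unramified `K`).

On K★'s locus (`p ∈ {5,7}`, `4 ≤ v_pΔ_min`, i.e. `v_p(c₄), v_p(c₆) ≥ 2`) the hypothesis `E₀(K)[p] = 0` holds over
every unramified `K` by g4's `StarredOptimalManinUnitFiveSevenUnramifiedTorsion.not_zsmul_eq_zero_of_one_le_norm_unramified`
(short model); in general it is Kosters–Pannekoek's `ā^{f} ≠ 1`.

References: [SilvermanAEC2009] J. H. Silverman, *The Arithmetic of Elliptic Curves*, 2nd ed. (2009), Prop. VII.2.1,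
VII.2.2, III.2.5 with Exercise 3.5, Thm. IV.6.4; [KimNakamura2020] C.-H. Kim, K. Nakamura, J. Number Theory 210
(2020), Thm. 2.1, Cor. 2.4, Remark 1.8 (1); [KostersPannekoek2017] M. Kosters, R. Pannekoek, arXiv:1703.07888,
Thm. 1, Lemma 7–8; [Kim2022StructureSelmer] C.-H. Kim, AJM 148 (2026) §3.2.3.
-/

set_option autoImplicit false
-- the Theorems namespace of a single-conjunct summit repeats the summit name by design (D-0017)
set_option linter.dupNamespace false

noncomputable section

open scoped Classical NNReal
open WeierstrassCurve Literature.NumberTheory.EllipticCurves Literature.NumberTheory.EllipticCurves.FormalGroupChart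

namespace Summit.BirchSwinnertonDyer.BirchSwinnertonDyer.Theorems.StarredOptimalManinUnitFiveSevenReceptacle

/-! ## §1 Pure algebra over a valued field: the index `[E₀ : E₁] = #k` at a cusp and the covering lemma -/

section Valued

universe u

variable {L : Type u} [Field L] (w : Valuation L ℝ≥0) (W₀ : WeierstrassCurve w.integer)

/-- **`[E₀(L) : E₁(L)] = #k` at CUSPIDAL reduction** (`Δ̃ = 0`, `c̃₄ = 0`) over a henselian valuation ring with
finite residue field `k`: the reduction `E₀(L) → Ẽ_ns(k)` is onto (Hensel, `reductionHom_surjective`) with kernel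
`E₁(L)` (`reductionHom_ker`), and a cuspidal cubic has exactly `#k` nonsingular points incl. `O`
(`natCard_point_of_Δ_eq_zero`: `Ẽ_ns ≅ 𝔾_a`).
[cite: SilvermanAEC2009, VII.2 Prop. 2.1 and III.2.5 with Exercise 3.5] -/
theorem index_kernelOfReduction_eq_card_of_cusp [Finite (IsLocalRing.ResidueField w.integer)]
    [HenselianRing w.integer (IsLocalRing.maximalIdeal w.integer)]
    (hΔ : IsLocalRing.residue w.integer W₀.Δ = 0) (hc₄ : IsLocalRing.residue w.integer W₀.c₄ = 0) :
    ((W₀.kernelOfReduction (Valuation.integer.integers w)).addSubgroupOf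
        (W₀.nonsingularReductionSubgroup (Valuation.integer.integers w))).index =
      Nat.card (IsLocalRing.ResidueField w.integer) := by
  have hv : w.Integers w.integer := Valuation.integer.integers w
  have hΔ' : (W₀.map (IsLocalRing.residue w.integer)).Δ = 0 := by rw [map_Δ, hΔ]
  have hc₄' : (W₀.map (IsLocalRing.residue w.integer)).c₄ = 0 := by rw [map_c₄, hc₄]
  rw [← reductionHom_ker hv, AddSubgroup.index_ker,
    AddMonoidHom.range_eq_top.mpr (W₀.reductionHom_surjective hv), AddSubgroup.card_top]
  exact ((W₀.map (IsLocalRing.residue w.integer)).natCard_point_of_Δ_eq_zero hΔ').2.2 hc₄'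

/-- ★ **The covering lemma (positive twin of the hidden-torsion obstruction).** `(L, w)` a valued field, `W₀` over
`𝒪 = w.integer` with CUSPIDAL reduction, `k` finite, `𝒪` henselian; `λ : E₀(L) →+ L` additive with
(i) `λ(E₀(L)) ⊆ 𝒪`, (ii) `λ⁻¹(𝔪) ⊆ E₁(L)` (`w(λ P) < 1 ⇒ P` reduces to `Õ`), (iii) `𝔪 ⊆ λ(E₀(L))`. Then
**`λ` covers `𝒪`**: every `o` with `w o ≤ 1` is `λ P` for some `P ∈ E₀(L)`. Counting: `μ = λ mod 𝔪 : E₀ → k⁺` has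
`ker μ ⊆ E₁`, so `#k ≥ #im μ = [E₀ : ker μ] ≥ [E₀ : E₁] = #k` (`index_kernelOfReduction_eq_card_of_cusp`); hence `μ` is
onto and `𝒪 = λ(E₀) + 𝔪 = λ(E₀)`. (For `λ = log_ω`: (i) is `p • E₀ ⊆ E₁`, `log_ω(E₁) = p𝒪`; (ii) is `E₀(L)[p] = 0`;
(iii) is Silverman IV.6.4(b).) [cite: SilvermanAEC2009, VII.2 Prop. 2.1, III.2.5 with Exercise 3.5, Thm. IV.6.4] -/
theorem forall_exists_eq_of_cusp [Finite (IsLocalRing.ResidueField w.integer)]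
    [HenselianRing w.integer (IsLocalRing.maximalIdeal w.integer)]
    (hΔ : IsLocalRing.residue w.integer W₀.Δ = 0) (hc₄ : IsLocalRing.residue w.integer W₀.c₄ = 0)
    (lam : W₀.nonsingularReductionSubgroup (Valuation.integer.integers w) →+ L)
    (hint : ∀ P, w (lam P) ≤ 1)
    (hker : ∀ P : W₀.nonsingularReductionSubgroup (Valuation.integer.integers w),
      w (lam P) < 1 → W₀.ReducesToZero (P : (W₀.baseChange L).toAffine.Point))
    (honto : ∀ o : L, w o < 1 → ∃ P, lam P = o) :
    ∀ o : L, w o ≤ 1 → ∃ P : W₀.nonsingularReductionSubgroup (Valuation.integer.integers w), lam P = o := by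
  have hv : w.Integers w.integer := Valuation.integer.integers w
  -- residues: `residue ⟨x, _⟩ = 0 ↔ w x < 1`
  have hres0 : ∀ (x : L) (hx : w x ≤ 1), IsLocalRing.residue w.integer ⟨x, hx⟩ = 0 ↔ w x < 1 := by
    intro x hx
    rw [← v_algebraMap_lt_one_iff hv ⟨x, hx⟩]
    exact Iff.rfl
  -- `λ` with values in `𝒪`, then `μ = λ mod 𝔪 : E₀ →+ k`
  let lam' : W₀.nonsingularReductionSubgroup (Valuation.integer.integers w) →+ w.integer :=
    { toFun := fun P => ⟨lam P, hint P⟩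
      map_zero' := Subtype.ext (by simp)
      map_add' := fun P Q => Subtype.ext (by simp) }
  let μ : W₀.nonsingularReductionSubgroup (Valuation.integer.integers w) →+
      IsLocalRing.ResidueField w.integer :=
    (IsLocalRing.residue w.integer).toAddMonoidHom.comp lam'
  have hμ : ∀ P, μ P = IsLocalRing.residue w.integer ⟨lam P, hint P⟩ := fun _ => rfl
  -- `ker μ ⊆ E₁`
  have hkerle : μ.ker ≤ (W₀.kernelOfReduction hv).addSubgroupOf (W₀.nonsingularReductionSubgroup hv) := by
    intro P hP
    rw [AddMonoidHom.mem_ker, hμ, hres0] at hP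
    rw [AddSubgroup.mem_addSubgroupOf, mem_kernelOfReduction_iff]
    exact hker P hP
  -- counting: `#k ≥ #im μ = [E₀ : ker μ] ≥ [E₀ : E₁] = #k`
  haveI : Finite μ.range := inferInstance
  have hidx : ((W₀.kernelOfReduction hv).addSubgroupOf (W₀.nonsingularReductionSubgroup hv)).index =
      Nat.card (IsLocalRing.ResidueField w.integer) :=
    index_kernelOfReduction_eq_card_of_cusp w W₀ hΔ hc₄
  have h2 : μ.ker.index = Nat.card μ.range := AddSubgroup.index_ker μ
  have hpos : 0 < μ.ker.index := by rw [h2]; exact Nat.card_pos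
  have h1 : Nat.card (IsLocalRing.ResidueField w.integer) ≤ μ.ker.index := by
    rw [← hidx]
    exact Nat.le_of_dvd hpos (AddSubgroup.index_dvd_of_le hkerle)
  have h3 : Nat.card μ.range ≤ Nat.card (IsLocalRing.ResidueField w.integer) :=
    Nat.card_le_card_of_injective (fun x : μ.range => (x : IsLocalRing.ResidueField w.integer))
      Subtype.val_injective
  have hrange : μ.range = ⊤ := by
    apply AddSubgroup.eq_top_of_card_eq
    exact le_antisymm h3 (by rw [← h2]; exact h1)
  have hμsurj : Function.Surjective μ := AddMonoidHom.range_eq_top.mp hrange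
  -- covering
  intro o ho
  obtain ⟨P, hP⟩ := hμsurj (IsLocalRing.residue w.integer ⟨o, ho⟩)
  rw [hμ] at hP
  have hsub1 : w (o - lam P) ≤ 1 := by
    have h := (⟨o, ho⟩ - ⟨lam P, hint P⟩ : w.integer).2
    exact h
  have hlt : w (o - lam P) < 1 := by
    rw [← hres0 _ hsub1]
    have e : (⟨o - lam P, hsub1⟩ : w.integer) = ⟨o, ho⟩ - ⟨lam P, hint P⟩ := Subtype.ext rfl
    rw [e, map_sub, hP, sub_self]
  obtain ⟨Q, hQ⟩ := honto _ hlt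
  exact ⟨Q + P, by rw [map_add, hQ, sub_add_cancel]⟩

end Valued

/-! ## §2 The KPort currency: `K/ℚ_p` finite unramified, `p` odd, cuspidal `M/ℤ_p`, `E₀(K)[p] = 0` -/

section KPort

open Summit.BirchSwinnertonDyer.Rank1Residual.Additive
open Summit.BirchSwinnertonDyer.Rank1Residual.Additive.BallEval
open Summit.BirchSwinnertonDyer.BirchSwinnertonDyer.Theorems.KPort
open Literature.NumberTheory.GaloisRepresentations.LubinTate (unitBall mem_unitBall_iff)

variable {p : ℕ} [hp : Fact p.Prime] {K : Type*} [NontriviallyNormedField K] [NormedAlgebra ℚ_[p] K]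
  [IsUltrametricDist K] [CompleteSpace K] {M : WeierstrassCurve ℤ_[p]}
  [hE : (M.map PadicInt.Coe.ringHom).IsElliptic]
  [hint : (curveK p K M).IsIntegral (NormedField.valuation (K := K)).integer]

/-- **`E₀(K)[p] = 0 ⇒ E₀(K)_tors ⊆ E₁(K)` (hence `E₀(K)_tors = 0`)** at cuspidal reduction over an unramified `K`,
`p` odd: for a torsion `T ∈ E₀(K)`, `p • T ∈ E₁(K)` is torsion, and `E₁(K)` is torsion-free
(`KPort.ptLog_eq_zero_iff_of_unramified`), so `p • T = O` and `T = O` by hypothesis.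
[cite: SilvermanAEC2009, VII.2 Prop. 2.1, VII.3 Prop. 3.1 and Thm. IV.6.4] -/
theorem eq_zero_of_isOfFinAddOrder_of_noPTorsion (hp2 : p ≠ 2) (hK : ∀ x : K, ‖x‖ < 1 → ‖x‖ ≤ ‖(p : K)‖)
    (hΔ : ‖M.Δ‖ < 1) (hc₄ : ‖M.c₄‖ < 1)
    (htors : ∀ P ∈ (M.map (coeffHom p K)).nonsingularReductionSubgroup
        (Valuation.integer.integers (NormedField.valuation (K := K))), p • P = 0 → P = 0)
    {T : (curveK p K M).toAffine.Point}
    (hT : T ∈ (M.map (coeffHom p K)).nonsingularReductionSubgroup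
      (Valuation.integer.integers (NormedField.valuation (K := K))))
    (hfin : IsOfFinAddOrder T) : T = 0 := by
  haveI : CharZero K := charZero_of_injective_algebraMap (algebraMap ℚ_[p] K).injective
  have hpT : p • T ∈ kernel (NormedField.valuation (K := K)) (curveK p K M) :=
    prime_nsmul_mem_kernel_of_mem_nonsingularReductionSubgroup hΔ hc₄ hT
  -- `p • T` is torsion in `E₁(K)`, hence `O`
  obtain ⟨n, hn, hnT⟩ := isOfFinAddOrder_iff_nsmul_eq_zero.mp hfin
  have hnpT : n • (p • T) = 0 := by rw [← mul_nsmul', mul_comm, mul_nsmul', hnT, nsmul_zero]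
  have h0 : ptLog p K M (n • (p • T)) = 0 := by rw [hnpT, ptLog_zero]
  rw [ptLog_nsmul hpT n, mul_eq_zero, or_iff_right (Nat.cast_ne_zero.mpr hn.ne')] at h0
  exact htors T hT ((ptLog_eq_zero_iff_of_unramified hp2 hK hpT).mp h0)

/-- **`‖Λ̃ P‖ < 1 ⇒ P ∈ E₁(K)`** for `P ∈ E₀(K)` (cusp, unramified `K`, `p` odd, `E₀(K)[p] = 0`): `Λ̃ P ∈ 𝔪 = p𝒪_K =
Λ(E₁(K))` (`KPort.exists_ptLog_eq_of_unramified`), say `= Λ Q`; then `Λ̃(P − Q) = 0`, so `P − Q` is torsion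
(`KPort.satLog_eq_zero_iff_isOfFinAddOrder_of_unramified`) in `E₀(K)`, hence `O`.
[cite: SilvermanAEC2009, VII.2 Prop. 2.1 and Thm. IV.6.4] -/
theorem mem_kernel_of_norm_satLog_lt_one (hp2 : p ≠ 2) (hK : ∀ x : K, ‖x‖ < 1 → ‖x‖ ≤ ‖(p : K)‖)
    (hΔ : ‖M.Δ‖ < 1) (hc₄ : ‖M.c₄‖ < 1)
    (htors : ∀ P ∈ (M.map (coeffHom p K)).nonsingularReductionSubgroup
        (Valuation.integer.integers (NormedField.valuation (K := K))), p • P = 0 → P = 0)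
    {P : (curveK p K M).toAffine.Point}
    (hP : P ∈ (M.map (coeffHom p K)).nonsingularReductionSubgroup
      (Valuation.integer.integers (NormedField.valuation (K := K))))
    (hlt : ‖satLog p K M P‖ < 1) :
    P ∈ kernel (NormedField.valuation (K := K)) (curveK p K M) := by
  obtain ⟨Q, hQ, hQP, -⟩ := exists_ptLog_eq_of_unramified (p := p) (M := M) hp2 hK hlt
  have hPs : P ∈ satKernel p K M := nonsingularReductionSubgroup_le_satKernel hΔ hc₄ hP
  have hQs : Q ∈ satKernel p K M := kernel_le_satKernel hQ
  have hsub : satLog p K M (P - Q) = 0 := by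
    rw [satLog_sub hPs hQs, satLog_of_mem hQ, hQP, sub_self]
  have hPQ0 : P - Q ∈ (M.map (coeffHom p K)).nonsingularReductionSubgroup
      (Valuation.integer.integers (NormedField.valuation (K := K))) :=
    AddSubgroup.sub_mem _ hP (kernel_le_nonsingularReductionSubgroup hQ)
  have hfin : IsOfFinAddOrder (P - Q) :=
    (satLog_eq_zero_iff_isOfFinAddOrder_of_unramified hp2 hK ((satKernel p K M).sub_mem hPs hQs)).mp hsub
  have h0 : P - Q = 0 := eq_zero_of_isOfFinAddOrder_of_noPTorsion hp2 hK hΔ hc₄ htors hPQ0 hfin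
  have hPQ : P = Q := sub_eq_zero.mp h0
  rw [hPQ]
  exact @hQ

/-- ★★ **THE SHARP RECEPTACLE: `Λ̃ : E₀(K) ↠ 𝒪_K`.** `K/ℚ_p` finite and UNRAMIFIED (`‖x‖ < 1 ⇒ ‖x‖ ≤ ‖p‖`),
`p` odd, `M/ℤ_p` with cuspidal reduction (`‖Δ‖, ‖c₄‖ < 1`), and `E₀(K)[p] = 0`: every `y ∈ 𝒪_K` is `Λ̃(P)` for some
`P ∈ E₀(K)` — with `‖Λ̃‖ ≤ 1` on `E₀(K)` this is `log_ω(E₀(K)) = 𝒪_K`, the log side of Kim–Nakamura's Cor. 2.4 /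
Kosters–Pannekoek over the unramified extension (their `E₀(K)[p] = 0 ⟺ ā^f ≠ 1`). §1's covering lemma with
(i) `KPort.norm_satLog_le_one_of_prime_nsmul_mem_of_unramified`, (ii) `mem_kernel_of_norm_satLog_lt_one`,
(iii) `KPort.exists_ptLog_eq_of_unramified`; `[E₀ : E₁] = #k` by Hensel (`henselianRing_unitBall`) and the cusp count.
[cite: KimNakamura2020, Thm. 2.1 and Cor. 2.4, Remark 1.8 (1)] [cite: KostersPannekoek2017, Thm. 1 and Lemma 7–8]
[cite: SilvermanAEC2009, VII.2 Prop. 2.1, III.2.5 with Exercise 3.5, Thm. IV.6.4] -/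
theorem exists_mem_nonsingularReductionSubgroup_satLog_eq [FiniteDimensional ℚ_[p] K] (hp2 : p ≠ 2)
    (hK : ∀ x : K, ‖x‖ < 1 → ‖x‖ ≤ ‖(p : K)‖) (hΔ : ‖M.Δ‖ < 1) (hc₄ : ‖M.c₄‖ < 1)
    (htors : ∀ P ∈ (M.map (coeffHom p K)).nonsingularReductionSubgroup
        (Valuation.integer.integers (NormedField.valuation (K := K))), p • P = 0 → P = 0)
    {y : K} (hy : ‖y‖ ≤ 1) :
    ∃ P ∈ (M.map (coeffHom p K)).nonsingularReductionSubgroup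
        (Valuation.integer.integers (NormedField.valuation (K := K))), satLog p K M P = y := by
  haveI := henselianRing_unitBall p K
  haveI := finite_residueField_unitBall p K
  have hv := Valuation.integer.integers (NormedField.valuation (K := K))
  -- `λ = Λ̃|_{E₀}` as a homomorphism
  have hle : (M.map (coeffHom p K)).nonsingularReductionSubgroup hv ≤ satKernel p K M :=
    nonsingularReductionSubgroup_le_satKernel hΔ hc₄
  let lam : (M.map (coeffHom p K)).nonsingularReductionSubgroup hv →+ K :=
    (satLogHom p K M).comp (AddSubgroup.inclusion hle)
  have hlam : ∀ P : (M.map (coeffHom p K)).nonsingularReductionSubgroup hv,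
      lam P = satLog p K M P.1 := fun _ => rfl
  have hnorm : ∀ x : K, NormedField.valuation (K := K) x ≤ 1 ↔ ‖x‖ ≤ 1 := fun x => by
    rw [← NNReal.coe_le_coe, NormedField.valuation_apply, coe_nnnorm, NNReal.coe_one]
  have hnorm' : ∀ x : K, NormedField.valuation (K := K) x < 1 ↔ ‖x‖ < 1 := fun x => by
    rw [← NNReal.coe_lt_coe, NormedField.valuation_apply, coe_nnnorm, NNReal.coe_one]
  have h := forall_exists_eq_of_cusp (NormedField.valuation (K := K)) (M.map (coeffHom p K))
    (residue_Δ_map_coeffHom_eq_zero hΔ) (residue_c₄_map_coeffHom_eq_zero hc₄) lam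
    (fun P => (hnorm _).mpr (by
      rw [hlam]
      exact norm_satLog_le_one_of_prime_nsmul_mem_of_unramified hp2 hK
        (prime_nsmul_mem_kernel_of_mem_nonsingularReductionSubgroup hΔ hc₄ P.2)))
    (fun P hP => by
      rw [hnorm', hlam] at hP
      exact (mem_kernel_iff_reducesToZero_curveK (M := M) P.1).mp
        (mem_kernel_of_norm_satLog_lt_one hp2 hK hΔ hc₄ htors P.2 hP))
    (fun o ho => by
      rw [hnorm'] at ho
      obtain ⟨Q, hQ, hQo, -⟩ := exists_ptLog_eq_of_unramified (p := p) (M := M) hp2 hK ho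
      exact ⟨⟨Q, kernel_le_nonsingularReductionSubgroup hQ⟩, by rw [hlam, satLog_of_mem hQ, hQo]⟩)
    y ((hnorm y).mpr hy)
  obtain ⟨P, hP⟩ := h
  exact ⟨P.1, P.2, by rw [← hlam, hP]⟩

/-- **`Λ̃(E₀(K)) = 𝒪_K = {y : ‖y‖ ≤ 1}`** (same hypotheses): `⊆` is `‖Λ̃‖ ≤ 1` on `E₀(K)` (`p • E₀ ⊆ E₁`,
`Λ(E₁) ⊆ p𝒪_K`), `⊇` is ★★. [cite: KimNakamura2020, Cor. 2.4] [cite: SilvermanAEC2009, VII.2 Prop. 2.1 and Thm. IV.6.4] -/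
theorem image_satLog_nonsingularReductionSubgroup_eq [FiniteDimensional ℚ_[p] K] (hp2 : p ≠ 2)
    (hK : ∀ x : K, ‖x‖ < 1 → ‖x‖ ≤ ‖(p : K)‖) (hΔ : ‖M.Δ‖ < 1) (hc₄ : ‖M.c₄‖ < 1)
    (htors : ∀ P ∈ (M.map (coeffHom p K)).nonsingularReductionSubgroup
        (Valuation.integer.integers (NormedField.valuation (K := K))), p • P = 0 → P = 0) :
    satLog p K M '' {P : (curveK p K M).toAffine.Point |
        P ∈ (M.map (coeffHom p K)).nonsingularReductionSubgroup
          (Valuation.integer.integers (NormedField.valuation (K := K)))} =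
      {y : K | ‖y‖ ≤ 1} := by
  ext y
  constructor
  · rintro ⟨P, hP, rfl⟩
    exact norm_satLog_le_one_of_prime_nsmul_mem_of_unramified hp2 hK
      (prime_nsmul_mem_kernel_of_mem_nonsingularReductionSubgroup hΔ hc₄ hP)
  · intro hy
    obtain ⟨P, hP, hPy⟩ := exists_mem_nonsingularReductionSubgroup_satLog_eq hp2 hK hΔ hc₄ htors hy
    exact ⟨P, hP, hPy⟩

/-- **`Λ̃` is injective on `E₀(K)`**: `Λ̃ P = 0 ↔ P = O` for `P ∈ E₀(K)` (cusp, unramified, `p` odd, `E₀(K)[p] = 0`) —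
`ker Λ̃ = E₀(K)_tors = 0`. So `Λ̃ : E₀(K) ⥲ 𝒪_K` is an isomorphism of groups.
[cite: SilvermanAEC2009, VII.2 Prop. 2.1 and Thm. IV.6.4] -/
theorem satLog_eq_zero_iff_of_mem_nonsingularReductionSubgroup (hp2 : p ≠ 2)
    (hK : ∀ x : K, ‖x‖ < 1 → ‖x‖ ≤ ‖(p : K)‖) (hΔ : ‖M.Δ‖ < 1) (hc₄ : ‖M.c₄‖ < 1)
    (htors : ∀ P ∈ (M.map (coeffHom p K)).nonsingularReductionSubgroup
        (Valuation.integer.integers (NormedField.valuation (K := K))), p • P = 0 → P = 0)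
    {P : (curveK p K M).toAffine.Point}
    (hP : P ∈ (M.map (coeffHom p K)).nonsingularReductionSubgroup
      (Valuation.integer.integers (NormedField.valuation (K := K)))) :
    satLog p K M P = 0 ↔ P = 0 := by
  refine ⟨fun h0 => ?_, fun h0 => by rw [h0, satLog_zero]⟩
  have hfin : IsOfFinAddOrder P :=
    (satLog_eq_zero_iff_isOfFinAddOrder_of_unramified hp2 hK
      (nonsingularReductionSubgroup_le_satKernel hΔ hc₄ hP)).mp h0
  exact eq_zero_of_isOfFinAddOrder_of_noPTorsion hp2 hK hΔ hc₄ htors hP hfin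

end KPort

/-! ## §3 The Literature logarithm `padicLogPointFiniteExt` of (S5b) and the trace form -/

section Literature

open Summit.BirchSwinnertonDyer.Rank1Residual.Additive
open Summit.BirchSwinnertonDyer.Rank1Residual.Additive.BallEval
open Summit.BirchSwinnertonDyer.BirchSwinnertonDyer.Theorems.KPort
open Literature.NumberTheory.GaloisRepresentations.LubinTate (unitBall mem_unitBall_iff)

variable {p : ℕ} [hp : Fact p.Prime] {K : Type*} [NontriviallyNormedField K] [NormedAlgebra ℚ_[p] K]
  [IsUltrametricDist K] [CompleteSpace K] {M : WeierstrassCurve ℤ_[p]}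
  [hE : (M.map PadicInt.Coe.ringHom).IsElliptic]
  [hint : (curveK p K M).IsIntegral (NormedField.valuation (K := K)).integer]

/-- ★★ in the currency of (S5b) `PAdicHodge.exists_smul_range_expStarCoord_iff_trace_log`: **every `y ∈ 𝒪_K` is
`log_ω(P) = FormalGroupChart.padicLogPointFiniteExt ‖·‖ E p P` for some `P ∈ E₀(K)`** (junction
`KPort.satLog_eq_padicLogPointFiniteExt`). [cite: KimNakamura2020, Cor. 2.4] [cite: SilvermanAEC2009, Thm. IV.6.4 with Prop. VII.2.2] -/
theorem exists_mem_nonsingularReductionSubgroup_padicLogPointFiniteExt_eq [FiniteDimensional ℚ_[p] K]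
    (hp2 : p ≠ 2) (hK : ∀ x : K, ‖x‖ < 1 → ‖x‖ ≤ ‖(p : K)‖) (hΔ : ‖M.Δ‖ < 1) (hc₄ : ‖M.c₄‖ < 1)
    (htors : ∀ P ∈ (M.map (coeffHom p K)).nonsingularReductionSubgroup
        (Valuation.integer.integers (NormedField.valuation (K := K))), p • P = 0 → P = 0)
    {y : K} (hy : ‖y‖ ≤ 1) :
    ∃ P ∈ (M.map (coeffHom p K)).nonsingularReductionSubgroup
        (Valuation.integer.integers (NormedField.valuation (K := K))),
      padicLogPointFiniteExt (NormedField.valuation (K := K)) (curveK p K M) p P = y := by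
  obtain ⟨P, hP, hPy⟩ := exists_mem_nonsingularReductionSubgroup_satLog_eq hp2 hK hΔ hc₄ htors hy
  exact ⟨P, hP, by rw [← satLog_eq_padicLogPointFiniteExt, hPy]⟩

/-- **The trace form, as consumed with (S5b).** Same hypotheses; if `a ∈ K` has
`‖Tr_{K/ℚ_p}(a · log_ω P)‖ ≤ 1` for every point `P ∈ E(K)` (the right-hand side of (S5b): `a` lies in the range of
`exp*_ω` on `H¹(K, T_pE)`), then `‖Tr_{K/ℚ_p}(a · o)‖ ≤ 1` for EVERY `o ∈ 𝒪_K` — i.e. `a ∈ 𝒪_K^∨`, which is `𝒪_K`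
for the unramified `K` (tree: `KimAtThreeSemiLocalTraceDualLocal.mem_adicCompletionIntegers_of_forall_trace_mul_mem`
at the cyclotomic completions). This is the RECEPTACLE `exp*_ω(H¹(K_v, T_pE)) ⊆ 𝒪_v^∨` of Kato's argument at an
additive prime over `K_v = ℚ(ζ_m)_v`. [cite: KimNakamura2020, Thm. 2.1 and Cor. 2.4] [cite: SilvermanAEC2009, Thm. IV.6.4] -/
theorem norm_trace_mul_le_one_of_forall_point [FiniteDimensional ℚ_[p] K]
    (hp2 : p ≠ 2) (hK : ∀ x : K, ‖x‖ < 1 → ‖x‖ ≤ ‖(p : K)‖) (hΔ : ‖M.Δ‖ < 1) (hc₄ : ‖M.c₄‖ < 1)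
    (htors : ∀ P ∈ (M.map (coeffHom p K)).nonsingularReductionSubgroup
        (Valuation.integer.integers (NormedField.valuation (K := K))), p • P = 0 → P = 0)
    {a : K}
    (ha : ∀ P : (curveK p K M).toAffine.Point,
      ‖Algebra.trace ℚ_[p] K (a * padicLogPointFiniteExt (NormedField.valuation (K := K)) (curveK p K M) p P)‖ ≤ 1)
    {o : K} (ho : ‖o‖ ≤ 1) : ‖Algebra.trace ℚ_[p] K (a * o)‖ ≤ 1 := by
  obtain ⟨P, -, hPo⟩ :=
    exists_mem_nonsingularReductionSubgroup_padicLogPointFiniteExt_eq hp2 hK hΔ hc₄ htors ho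
  rw [← hPo]
  exact ha P

end Literature

end Summit.BirchSwinnertonDyer.BirchSwinnertonDyer.Theorems.StarredOptimalManinUnitFiveSevenReceptacle

end
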